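import Mathlib
import Summits.Ventures.PercRepro2.StarOXhatB

/-!
# The mean field `X̂` when `a₃` is adjacent only to `a₁`, `a₂` and `b`, part A: the rows with
`b ∈ C(a₃)` (blind cell PercRepro2, night-1 g9; NIGHT1-G8.md §2, NIGHT1-G9.md §2)

Class B = the three-coin star `f₁ = {a₃, a₁}` (α), `f₂ = {a₃, a₂}` (β), `f₃ = {a₃, b}` (s).
Unlike class O (StarOXhatB), the rows of `X̂` whose cluster contains `b` do NOT vanish: on a row
`W ∋ b` with one root, `termT` is the plain residual share `P_{G∖W}(x ↔ o)` of the free root `x`,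
and the row sum over an outcome `O` with the `b`-coin open is, by the domain Markov property row by
row (`prob_cl_outc_del`) and the cluster partition (`prob_eq_sum_clusterEvent`),
`P(O, a₁ ∈ C(a₃), a₂ ∉ C(a₃), a₂ ↔ o) + P(O, a₂ ∈ C(a₃), a₁ ∉ C(a₃), a₁ ↔ o)`
(`sum_rows_of_outc_b`).  The glue calculus of the star evaluates these: with only `f₃` open they
are `P₀(Q, b ∈ C₁, o ∈ C₂) + P₀(Q, b ∈ C₂, o ∈ C₁)`, with `f₁, f₃` open `P₀(Q, b ∉ C₂, o ∈ C₂)`,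
with `f₂, f₃` open the mirror.  The rows with the `b`-coin closed are those of class O with the
third vertex renamed (`sum_ccc_rows_b`, `sum_f1_rows_b`, `sum_f2_rows_b`).  Result:

  `X̂ = ᾱβ̄s̄·X₀ + αβ̄s̄·Y_T′ + ᾱβs̄·Y_T + ᾱβ̄s·(P_HL + P_LH) + αβ̄s·(A_H − P_HH) + ᾱβs·(A_L − P_LL)`

(`Xhat_star_b`), the `XhatMass` of StarBCert.
-/

namespace Summit.Ventures.PercRepro2

open StarGlue PendantRoot UnionCluster StarO

namespace StarB

section Aux

variable {V : Type*} {E : Type*} (ends : E → Sym2 V) {a₃ : V}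

/-- On `{C(a₃) = W}`, `a₃ ↔ x` iff `x ∈ W`. -/
lemma cl_conn_iff {W : Finset V} {ω : Config E} (hω : ω ∈ clusterEvent ends a₃ (↑W : Set V))
    (x : V) : Conn ends ω a₃ x ↔ x ∈ W := by
  rw [mem_clusterEvent] at hω
  have : x ∈ cluster ends ω a₃ ↔ x ∈ (↑W : Set V) := by rw [hω]
  simpa [mem_cluster] using this

/-- On `{C(a₃) = W} ∩ O`, for `u ∉ W` the connection `{u ↔ w}` is the residual one. -/
lemma cl_inter_conn_eq_del_outc [Fintype V] [DecidableEq V] {W : Finset V} {u w : V} (hu : u ∉ W)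
    (O : Set (Config E)) :
    clusterEvent ends a₃ (↑W : Set V) ∩ O ∩ connEvent ends u w =
      clusterEvent ends a₃ (↑W : Set V) ∩ O ∩ connDelEvent ends W u w := by
  have h := cl_inter_conn_eq_del ends a₃ W (w := w) hu
  rw [Set.inter_right_comm, h, Set.inter_right_comm]

end Aux

section Rows

variable {V : Type*} {E : Type*} [Fintype E] [DecidableEq E] [Fintype V] [DecidableEq V]
  {R : Type*} [Field R] [LinearOrder R] [IsStrictOrderedRing R]

variable (p : E → R) (ends : E → Sym2 V) {f₁ f₂ f₃ : E} {a₃ a₁ a₂ o b : V}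

omit [LinearOrder R] [IsStrictOrderedRing R] in
/-- On a row containing `b` and `a₁` but not `a₂`, `termW` is the residual share of `a₂` to `o`. -/
lemma termW_of_b_left {W : Finset V} (h1 : a₁ ∈ W) (h2 : a₂ ∉ W) (hb : b ∈ W) :
    termW p ends o a₁ a₂ b W = delConnProb p ends W a₂ o := by
  simp [termW, termT, h1, h2, hb]

omit [LinearOrder R] [IsStrictOrderedRing R] in
/-- On a row containing `b` and `a₂` but not `a₁`, `termW` is the residual share of `a₁` to `o`. -/
lemma termW_of_b_right {W : Finset V} (h1 : a₁ ∉ W) (h2 : a₂ ∈ W) (hb : b ∈ W) :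
    termW p ends o a₁ a₂ b W = delConnProb p ends W a₁ o := by
  simp [termW, termT, h1, h2, hb]

omit [LinearOrder R] [IsStrictOrderedRing R] in
/-- On a row containing `b` and no root, the PD-term vanishes (`b` carries no residual share). -/
lemma termW_of_b_none {W : Finset V} (h1 : a₁ ∉ W) (h2 : a₂ ∉ W) (hb : b ∈ W) :
    termW p ends o a₁ a₂ b W = 0 := by
  simp [termW, termPD, delShareMass, h1, h2, hb]

omit [LinearOrder R] [IsStrictOrderedRing R] in
/-- On a row containing both roots, `termW` vanishes. -/
lemma termW_of_both {W : Finset V} (h1 : a₁ ∈ W) (h2 : a₂ ∈ W) :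
    termW p ends o a₁ a₂ b W = 0 := by
  simp [termW, h1, h2]

omit [Fintype E] [DecidableEq E] [Fintype V] [DecidableEq V] [LinearOrder R]
  [IsStrictOrderedRing R] in
/-- The outcome event is determined by the three coins. -/
lemma dependsOn_outc (f₁ f₂ f₃ : E) (b₁ b₂ b₃ : Bool) :
    DependsOn (· ∈ outc f₁ f₂ f₃ b₁ b₂ b₃) ({f₁, f₂, f₃} : Set E) := by
  intro ω ω' h
  show (ω f₁ = b₁ ∧ ω f₂ = b₂ ∧ ω f₃ = b₃) = (ω' f₁ = b₁ ∧ ω' f₂ = b₂ ∧ ω' f₃ = b₃)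
  rw [h f₁ (by simp), h f₂ (by simp), h f₃ (by simp)]

omit [LinearOrder R] [IsStrictOrderedRing R] in
/-- **Domain Markov row by row, with the coins**: for `a₃ ∈ W` the coin outcome is determined by
edges touching `W`, so `{C(a₃) = W} ∩ O` is independent of the residual connection. -/
lemma prob_cl_outc_del (hf₁ : ends f₁ = s(a₃, a₁)) (hf₂ : ends f₂ = s(a₃, a₂))
    (hf₃ : ends f₃ = s(a₃, b)) {W : Finset V} (h3W : a₃ ∈ W) (b₁ b₂ b₃ : Bool) (x y : V) :
    prob p (clusterEvent ends a₃ (↑W : Set V) ∩ outc f₁ f₂ f₃ b₁ b₂ b₃ ∩ connDelEvent ends W x y) =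
      prob p (clusterEvent ends a₃ (↑W : Set V) ∩ outc f₁ f₂ f₃ b₁ b₂ b₃) *
        prob p (connDelEvent ends W x y) := by
  have hsub : ({f₁, f₂, f₃} : Set E) ⊆ touches ends (↑W : Set V) := by
    intro e he
    simp only [Set.mem_insert_iff, Set.mem_singleton_iff] at he
    rcases he with rfl | rfl | rfl
    · exact mem_touches_of_ends hf₁ (Or.inl (Finset.mem_coe.2 h3W))
    · exact mem_touches_of_ends hf₂ (Or.inl (Finset.mem_coe.2 h3W))
    · exact mem_touches_of_ends hf₃ (Or.inl (Finset.mem_coe.2 h3W))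
  have hA : DependsOn (· ∈ clusterEvent ends a₃ (↑W : Set V) ∩ outc f₁ f₂ f₃ b₁ b₂ b₃)
      (touches ends (↑W : Set V)) := by
    have h := dependsOn_inter (dependsOn_clusterEvent ends a₃ (↑W : Set V))
      (dependsOn_outc f₁ f₂ f₃ b₁ b₂ b₃)
    exact DependsOn.mono (Set.union_subset (subset_refl _) hsub) h
  have hB : DependsOn (· ∈ connDelEvent ends W x y) (touches ends (↑W : Set V))ᶜ :=
    dependsOn_restrict (touches ends (↑W : Set V))ᶜ (fun ω' => Conn ends ω' x y)
  exact prob_inter_eq_mul_of_dependsOn p disjoint_compl_right hA hB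

omit [LinearOrder R] [IsStrictOrderedRing R] in
/-- **The row sum of an outcome on which `b ∈ C(a₃)`**: the rows with one root carry the residual
share of the free root to `o`, which the domain Markov property turns into the plain connection;
the rows with no root or both roots vanish. -/
theorem sum_rows_of_outc_b (hf₁ : ends f₁ = s(a₃, a₁))
    (hf₂ : ends f₂ = s(a₃, a₂)) (hf₃ : ends f₃ = s(a₃, b)) (b₁ b₂ : Bool) :
    ∑ W : Finset V, prob p (clusterEvent ends a₃ (↑W : Set V) ∩ outc f₁ f₂ f₃ b₁ b₂ true) *
        termW p ends o a₁ a₂ b W =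
      prob p (outc f₁ f₂ f₃ b₁ b₂ true ∩ connEvent ends a₃ a₁ ∩ (connEvent ends a₃ a₂)ᶜ ∩
          connEvent ends a₂ o) +
        prob p (outc f₁ f₂ f₃ b₁ b₂ true ∩ connEvent ends a₃ a₂ ∩ (connEvent ends a₃ a₁)ᶜ ∩
          connEvent ends a₁ o) := by
  rw [prob_eq_sum_clusterEvent p ends a₃ (outc f₁ f₂ f₃ b₁ b₂ true ∩ connEvent ends a₃ a₁ ∩
      (connEvent ends a₃ a₂)ᶜ ∩ connEvent ends a₂ o),
    prob_eq_sum_clusterEvent p ends a₃ (outc f₁ f₂ f₃ b₁ b₂ true ∩ connEvent ends a₃ a₂ ∩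
      (connEvent ends a₃ a₁)ᶜ ∩ connEvent ends a₁ o), ← Finset.sum_add_distrib]
  refine Finset.sum_congr rfl fun W _ => ?_
  -- `b ∈ C(a₃)` on the outcome
  have hbW : ∀ ω ∈ clusterEvent ends a₃ (↑W : Set V) ∩ outc f₁ f₂ f₃ b₁ b₂ true, b ∈ W := by
    rintro ω ⟨hω, hO⟩
    exact (cl_conn_iff ends hω b).1 (conn_a3_o_of_f3 hf₃ (mem_outc.1 hO).2.2)
  by_cases h3W : a₃ ∈ W
  · by_cases hb : b ∈ W
    · by_cases h1 : a₁ ∈ W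
      · by_cases h2 : a₂ ∈ W
        · -- both roots: everything vanishes
          rw [termW_of_both p ends h1 h2, mul_zero]
          have e1 : clusterEvent ends a₃ (↑W : Set V) ∩ (outc f₁ f₂ f₃ b₁ b₂ true ∩
              connEvent ends a₃ a₁ ∩ (connEvent ends a₃ a₂)ᶜ ∩ connEvent ends a₂ o) = ∅ := by
            ext ω
            simp only [Set.mem_inter_iff, Set.mem_compl_iff, mem_connEvent,
              Set.mem_empty_iff_false, iff_false]
            rintro ⟨hω, ⟨⟨_, _⟩, hn⟩, _⟩
            exact hn ((cl_conn_iff ends hω a₂).2 h2)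
          have e2 : clusterEvent ends a₃ (↑W : Set V) ∩ (outc f₁ f₂ f₃ b₁ b₂ true ∩
              connEvent ends a₃ a₂ ∩ (connEvent ends a₃ a₁)ᶜ ∩ connEvent ends a₁ o) = ∅ := by
            ext ω
            simp only [Set.mem_inter_iff, Set.mem_compl_iff, mem_connEvent,
              Set.mem_empty_iff_false, iff_false]
            rintro ⟨hω, ⟨⟨_, _⟩, hn⟩, _⟩
            exact hn ((cl_conn_iff ends hω a₁).2 h1)
          rw [e1, e2, prob_empty, add_zero]
        · -- `a₁ ∈ W`, `a₂ ∉ W`: the residual share of `a₂`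
          rw [termW_of_b_left p ends h1 h2 hb]
          have e2 : clusterEvent ends a₃ (↑W : Set V) ∩ (outc f₁ f₂ f₃ b₁ b₂ true ∩
              connEvent ends a₃ a₂ ∩ (connEvent ends a₃ a₁)ᶜ ∩ connEvent ends a₁ o) = ∅ := by
            ext ω
            simp only [Set.mem_inter_iff, Set.mem_compl_iff, mem_connEvent,
              Set.mem_empty_iff_false, iff_false]
            rintro ⟨hω, ⟨⟨_, h⟩, _⟩, _⟩
            exact h2 ((cl_conn_iff ends hω a₂).1 h)
          rw [e2, prob_empty, add_zero]
          have e1 : clusterEvent ends a₃ (↑W : Set V) ∩ (outc f₁ f₂ f₃ b₁ b₂ true ∩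
              connEvent ends a₃ a₁ ∩ (connEvent ends a₃ a₂)ᶜ ∩ connEvent ends a₂ o) =
              clusterEvent ends a₃ (↑W : Set V) ∩ outc f₁ f₂ f₃ b₁ b₂ true ∩ connEvent ends a₂ o := by
            ext ω
            simp only [Set.mem_inter_iff, Set.mem_compl_iff, mem_connEvent]
            constructor
            · rintro ⟨hω, ⟨⟨⟨hO, _⟩, _⟩, h⟩⟩; exact ⟨⟨hω, hO⟩, h⟩
            · rintro ⟨⟨hω, hO⟩, h⟩
              exact ⟨hω, ⟨⟨⟨hO, (cl_conn_iff ends hω a₁).2 h1⟩,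
                fun h' => h2 ((cl_conn_iff ends hω a₂).1 h')⟩, h⟩⟩
          rw [e1]
          by_cases hoW : o ∈ W
          · -- `o ∈ W`: the share is `0` and the event is empty (`a₂ ↔ o ∈ C(a₃)` would put `a₂` in `W`)
            have hd : delConnProb p ends W a₂ o = 0 := by simp [delConnProb, hoW]
            have e0 : clusterEvent ends a₃ (↑W : Set V) ∩ outc f₁ f₂ f₃ b₁ b₂ true ∩
                connEvent ends a₂ o = ∅ := by
              ext ω
              simp only [Set.mem_inter_iff, mem_connEvent, Set.mem_empty_iff_false, iff_false]
              rintro ⟨⟨hω, _⟩, h⟩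
              exact h2 ((cl_conn_iff ends hω a₂).1
                (conn_trans ((cl_conn_iff ends hω o).2 hoW) (conn_symm h)))
            rw [hd, mul_zero, e0, prob_empty]
          · have hd : delConnProb p ends W a₂ o = prob p (connDelEvent ends W a₂ o) := by
              simp [delConnProb, hoW]
            rw [hd, cl_inter_conn_eq_del_outc ends h2 _, prob_cl_outc_del p ends hf₁ hf₂ hf₃ h3W]
      · by_cases h2 : a₂ ∈ W
        · -- `a₂ ∈ W`, `a₁ ∉ W`: the residual share of `a₁`
          rw [termW_of_b_right p ends h1 h2 hb]
          have e1 : clusterEvent ends a₃ (↑W : Set V) ∩ (outc f₁ f₂ f₃ b₁ b₂ true ∩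
              connEvent ends a₃ a₁ ∩ (connEvent ends a₃ a₂)ᶜ ∩ connEvent ends a₂ o) = ∅ := by
            ext ω
            simp only [Set.mem_inter_iff, Set.mem_compl_iff, mem_connEvent,
              Set.mem_empty_iff_false, iff_false]
            rintro ⟨hω, ⟨⟨_, h⟩, _⟩, _⟩
            exact h1 ((cl_conn_iff ends hω a₁).1 h)
          rw [e1, prob_empty, zero_add]
          have e2 : clusterEvent ends a₃ (↑W : Set V) ∩ (outc f₁ f₂ f₃ b₁ b₂ true ∩
              connEvent ends a₃ a₂ ∩ (connEvent ends a₃ a₁)ᶜ ∩ connEvent ends a₁ o) =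
              clusterEvent ends a₃ (↑W : Set V) ∩ outc f₁ f₂ f₃ b₁ b₂ true ∩ connEvent ends a₁ o := by
            ext ω
            simp only [Set.mem_inter_iff, Set.mem_compl_iff, mem_connEvent]
            constructor
            · rintro ⟨hω, ⟨⟨⟨hO, _⟩, _⟩, h⟩⟩; exact ⟨⟨hω, hO⟩, h⟩
            · rintro ⟨⟨hω, hO⟩, h⟩
              exact ⟨hω, ⟨⟨⟨hO, (cl_conn_iff ends hω a₂).2 h2⟩,
                fun h' => h1 ((cl_conn_iff ends hω a₁).1 h')⟩, h⟩⟩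
          rw [e2]
          by_cases hoW : o ∈ W
          · have hd : delConnProb p ends W a₁ o = 0 := by simp [delConnProb, hoW]
            have e0 : clusterEvent ends a₃ (↑W : Set V) ∩ outc f₁ f₂ f₃ b₁ b₂ true ∩
                connEvent ends a₁ o = ∅ := by
              ext ω
              simp only [Set.mem_inter_iff, mem_connEvent, Set.mem_empty_iff_false, iff_false]
              rintro ⟨⟨hω, _⟩, h⟩
              exact h1 ((cl_conn_iff ends hω a₁).1
                (conn_trans ((cl_conn_iff ends hω o).2 hoW) (conn_symm h)))
            rw [hd, mul_zero, e0, prob_empty]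
          · have hd : delConnProb p ends W a₁ o = prob p (connDelEvent ends W a₁ o) := by
              simp [delConnProb, hoW]
            rw [hd, cl_inter_conn_eq_del_outc ends h1 _, prob_cl_outc_del p ends hf₁ hf₂ hf₃ h3W]
        · -- no root: both sides vanish
          rw [termW_of_b_none p ends h1 h2 hb, mul_zero]
          have e1 : clusterEvent ends a₃ (↑W : Set V) ∩ (outc f₁ f₂ f₃ b₁ b₂ true ∩
              connEvent ends a₃ a₁ ∩ (connEvent ends a₃ a₂)ᶜ ∩ connEvent ends a₂ o) = ∅ := by
            ext ω
            simp only [Set.mem_inter_iff, Set.mem_compl_iff, mem_connEvent,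
              Set.mem_empty_iff_false, iff_false]
            rintro ⟨hω, ⟨⟨_, h⟩, _⟩, _⟩
            exact h1 ((cl_conn_iff ends hω a₁).1 h)
          have e2 : clusterEvent ends a₃ (↑W : Set V) ∩ (outc f₁ f₂ f₃ b₁ b₂ true ∩
              connEvent ends a₃ a₂ ∩ (connEvent ends a₃ a₁)ᶜ ∩ connEvent ends a₁ o) = ∅ := by
            ext ω
            simp only [Set.mem_inter_iff, Set.mem_compl_iff, mem_connEvent,
              Set.mem_empty_iff_false, iff_false]
            rintro ⟨hω, ⟨⟨_, h⟩, _⟩, _⟩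
            exact h2 ((cl_conn_iff ends hω a₂).1 h)
          rw [e1, e2, prob_empty, add_zero]
    · -- `b ∉ W`: the row is empty on the outcome
      have e0 : clusterEvent ends a₃ (↑W : Set V) ∩ outc f₁ f₂ f₃ b₁ b₂ true = ∅ := by
        ext ω
        simp only [Set.mem_empty_iff_false, iff_false]
        intro h
        exact hb (hbW ω h)
      have e1 : clusterEvent ends a₃ (↑W : Set V) ∩ (outc f₁ f₂ f₃ b₁ b₂ true ∩
          connEvent ends a₃ a₁ ∩ (connEvent ends a₃ a₂)ᶜ ∩ connEvent ends a₂ o) = ∅ := by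
        rw [← Set.subset_empty_iff, ← e0]
        rintro ω ⟨hω, ⟨⟨⟨hO, _⟩, _⟩, _⟩⟩; exact ⟨hω, hO⟩
      have e2 : clusterEvent ends a₃ (↑W : Set V) ∩ (outc f₁ f₂ f₃ b₁ b₂ true ∩
          connEvent ends a₃ a₂ ∩ (connEvent ends a₃ a₁)ᶜ ∩ connEvent ends a₁ o) = ∅ := by
        rw [← Set.subset_empty_iff, ← e0]
        rintro ω ⟨hω, ⟨⟨⟨hO, _⟩, _⟩, _⟩⟩; exact ⟨hω, hO⟩
      rw [e0, e1, e2, prob_empty, zero_mul, add_zero]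
  · -- `a₃ ∉ W`: the cluster event is empty
    have e0 : clusterEvent ends a₃ (↑W : Set V) = ∅ := by
      ext ω
      simp only [mem_clusterEvent, Set.mem_empty_iff_false, iff_false]
      intro hW
      exact h3W (Finset.mem_coe.1 (hW ▸ mem_cluster_self ends ω a₃))
    rw [e0, Set.empty_inter, Set.empty_inter, Set.empty_inter, prob_empty, zero_mul, add_zero]

omit [Fintype E] [DecidableEq E] in
/-- The star-closed connection between vertices other than `a₃` on an outcome with the two root
coins closed (at most one coin open). -/
lemma conn_single_of_outc (hf₁ : ends f₁ = s(a₃, a₁)) (hf₂ : ends f₂ = s(a₃, a₂))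
    (hf₃ : ends f₃ = s(a₃, b)) (hstar : ∀ e, a₃ ∈ ends e → e = f₁ ∨ e = f₂ ∨ e = f₃)
    (h31 : a₃ ≠ a₁) (h32 : a₃ ≠ a₂) (h3b : a₃ ≠ b) {ω : Config E} (h1 : ω f₁ = false)
    (h2 : ω f₂ = false) {x y : V} (hx : x ≠ a₃) (hy : y ≠ a₃) :
    Conn ends ω x y ↔ Conn ends (closeStar ends a₃ ω) x y :=
  conn_iff_single hf₁ hf₂ hf₃ hstar h31 h32 h3b (by simp [h1]) (by simp [h1]) (by simp [h2]) hx hy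

omit [Fintype E] [DecidableEq E] in
/-- With only the `b`-coin open: `{a₁ ∈ C(a₃), a₂ ∉ C(a₃), a₂ ↔ o}` is `Q₁ ∩ {b ∈ C₁} ∩ {o ∈ C₂}`
seen through the closed star. -/
lemma outc_f3_left (hf₁ : ends f₁ = s(a₃, a₁)) (hf₂ : ends f₂ = s(a₃, a₂))
    (hf₃ : ends f₃ = s(a₃, b)) (hstar : ∀ e, a₃ ∈ ends e → e = f₁ ∨ e = f₂ ∨ e = f₃)
    (h31 : a₃ ≠ a₁) (h32 : a₃ ≠ a₂) (h3o : a₃ ≠ o) (h3b : a₃ ≠ b) :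
    outc f₁ f₂ f₃ false false true ∩ connEvent ends a₃ a₁ ∩ (connEvent ends a₃ a₂)ᶜ ∩
        connEvent ends a₂ o =
      viaStar ends a₃ (avoidAll ends a₂ {a₁} ∩ connEvent ends a₁ b ∩ connEvent ends a₂ o) ∩
        outc f₁ f₂ f₃ false false true := by
  ext ω
  simp only [Set.mem_inter_iff, Set.mem_compl_iff, mem_connEvent, mem_outc, viaStar,
    Set.mem_setOf_eq, avoidAll_eq_compl]
  constructor
  · rintro ⟨⟨⟨⟨h1, h2, h3⟩, hc1⟩, hn2⟩, hc⟩
    have hs : ∀ {x y : V}, x ≠ a₃ → y ≠ a₃ →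
        (Conn ends ω x y ↔ Conn ends (closeStar ends a₃ ω) x y) := fun hx hy =>
      conn_single_of_outc ends hf₁ hf₂ hf₃ hstar h31 h32 h3b h1 h2 hx hy
    rw [conn_a3_iff_o_of_f3 hf₃ h3, hs h3b.symm h31.symm] at hc1
    rw [conn_a3_iff_o_of_f3 hf₃ h3, hs h3b.symm h32.symm] at hn2
    rw [hs h32.symm h3o.symm] at hc
    refine ⟨⟨⟨fun h => hn2 (conn_trans hc1 h), conn_symm hc1⟩, hc⟩, h1, h2, h3⟩
  · rintro ⟨⟨⟨hQ, hb⟩, hc⟩, h1, h2, h3⟩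
    have hs : ∀ {x y : V}, x ≠ a₃ → y ≠ a₃ →
        (Conn ends ω x y ↔ Conn ends (closeStar ends a₃ ω) x y) := fun hx hy =>
      conn_single_of_outc ends hf₁ hf₂ hf₃ hstar h31 h32 h3b h1 h2 hx hy
    refine ⟨⟨⟨⟨h1, h2, h3⟩, ?_⟩, ?_⟩, ?_⟩
    · rw [conn_a3_iff_o_of_f3 hf₃ h3, hs h3b.symm h31.symm]; exact conn_symm hb
    · rw [conn_a3_iff_o_of_f3 hf₃ h3, hs h3b.symm h32.symm]
      exact fun h => hQ (conn_trans hb h)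
    · rw [hs h32.symm h3o.symm]; exact hc

omit [Fintype E] [DecidableEq E] in
/-- With only the `b`-coin open: `{a₂ ∈ C(a₃), a₁ ∉ C(a₃), a₁ ↔ o}` is `Q₁ ∩ {b ∈ C₂} ∩ {o ∈ C₁}`
seen through the closed star. -/
lemma outc_f3_right (hf₁ : ends f₁ = s(a₃, a₁)) (hf₂ : ends f₂ = s(a₃, a₂))
    (hf₃ : ends f₃ = s(a₃, b)) (hstar : ∀ e, a₃ ∈ ends e → e = f₁ ∨ e = f₂ ∨ e = f₃)
    (h31 : a₃ ≠ a₁) (h32 : a₃ ≠ a₂) (h3o : a₃ ≠ o) (h3b : a₃ ≠ b) :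
    outc f₁ f₂ f₃ false false true ∩ connEvent ends a₃ a₂ ∩ (connEvent ends a₃ a₁)ᶜ ∩
        connEvent ends a₁ o =
      viaStar ends a₃ (avoidAll ends a₂ {a₁} ∩ connEvent ends a₂ b ∩ connEvent ends a₁ o) ∩
        outc f₁ f₂ f₃ false false true := by
  ext ω
  simp only [Set.mem_inter_iff, Set.mem_compl_iff, mem_connEvent, mem_outc, viaStar,
    Set.mem_setOf_eq, avoidAll_eq_compl]
  constructor
  · rintro ⟨⟨⟨⟨h1, h2, h3⟩, hc2⟩, hn1⟩, hc⟩
    have hs : ∀ {x y : V}, x ≠ a₃ → y ≠ a₃ →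
        (Conn ends ω x y ↔ Conn ends (closeStar ends a₃ ω) x y) := fun hx hy =>
      conn_single_of_outc ends hf₁ hf₂ hf₃ hstar h31 h32 h3b h1 h2 hx hy
    rw [conn_a3_iff_o_of_f3 hf₃ h3, hs h3b.symm h32.symm] at hc2
    rw [conn_a3_iff_o_of_f3 hf₃ h3, hs h3b.symm h31.symm] at hn1
    rw [hs h31.symm h3o.symm] at hc
    refine ⟨⟨⟨fun h => hn1 (conn_trans hc2 (conn_symm h)), conn_symm hc2⟩, hc⟩, h1, h2, h3⟩
  · rintro ⟨⟨⟨hQ, hb⟩, hc⟩, h1, h2, h3⟩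
    have hs : ∀ {x y : V}, x ≠ a₃ → y ≠ a₃ →
        (Conn ends ω x y ↔ Conn ends (closeStar ends a₃ ω) x y) := fun hx hy =>
      conn_single_of_outc ends hf₁ hf₂ hf₃ hstar h31 h32 h3b h1 h2 hx hy
    refine ⟨⟨⟨⟨h1, h2, h3⟩, ?_⟩, ?_⟩, ?_⟩
    · rw [conn_a3_iff_o_of_f3 hf₃ h3, hs h3b.symm h32.symm]; exact conn_symm hb
    · rw [conn_a3_iff_o_of_f3 hf₃ h3, hs h3b.symm h31.symm]
      exact fun h => hQ (conn_symm (conn_trans hb h))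
    · rw [hs h31.symm h3o.symm]; exact hc

end Rows

end StarB

end Summit.Ventures.PercRepro2
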